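import Summits.Ventures.Crystal3D.Bulk.GapVertexStar
import Literature.Geometry.DiscreteGeometry.KissingAngleBounds
import HarnessLib

/-!
# Touching tight partners are cyclically consecutive: the first half of the pre-LP filter F2
# ("vertex links are linear forests") of the A-lineage census, in the kernel and face-free

HONEST FRAMING. Part of the venture `Summits/Ventures/Crystal3D` (cell `pub-crystal3d`, phase 2;
seat p2, PROMOTION-AUDIT prep). Kernel theorems about ADMISSIBLE fourteen-ball configurations
(`IsGapConfig c`; no extremality, no plane map, no face); nothing here asserts anything about
GAP(1.26), and no census number moves. Purpose: the A-family audit dossier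
(`phase2/ENV-CENSUS/impla/audit-prep-g8/A-FAMILY-AUDIT-DOSSIER-engine4-g8.md` §2.1 row F2, §8
F-A2) records that implementation A (`alp.py`, `links_linear_forests`, l.780–805) DISCARDS,
before any LP, every plantri map with a vertex `v` whose LINK (the subgraph induced on the
neighbours of `v`) is not a linear forest (max degree `≤ 2`, no cycle), on the strength of a paper
argument (`phase2/ENV-CENSUS/DESIGN.md` §2 F2: "only azimuth-CONSECUTIVE neighbours of `v` can
touch, and not all `d` consecutive gaps can be tight-triangle corners"), and asks for a tree fact.
THIS file and its sequel `Bulk/GapLinkForest.lean` supply it, in the vocabulary of the two-level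
vertex star (`Bulk/GapVertexStar.lean`: `tightNbrs`, sorted azimuths `sortedTightAngle`, cyclic
order `tightNbrAt`, gaps `tightGap`, `sum_tightGap = 2π`, `tightGap_eq_corner`):

* §1 real/index lemmas: `cos x ≤ cos a` on `[a, 2π − a]`; `two_gaps_le_of_not_consecutive` (two
  sorted positions that are not cyclically consecutive have at least two gaps on EACH side);
  `sum_erase_ge`.
* §2 `IsGapConfig.cos_tightAzimuth_sub`: for tight partners `j, j'` of `i`,
  `cos (θ_{j'} − θ_j) = cos (corner c i j' j)`; the constants `C_x(D) = D/(√3 √(4−D²)) = cos A_x`,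
  `C_p(D) = (2−D²)/(4−D²) = cos A_p` (`Cx_bounds`, `Cp_bounds`); **every gap at a shell ball is
  `≥ A_x(D)`** (`IsGapConfig.Ax_le_tightGap`, from R-min `≥ α₀ ≥ A_x` / `≥ A_x`) and **every gap
  at the hole is `≥ A_p(D)`** (`IsGapConfig.Ap_le_tightGap`).
* §3 **F2 (a)**: `IsGapConfig.touch_consecutive_shell` (`D² < 8/3`) and
  `IsGapConfig.touch_consecutive_intruder` (`D² < 2`): if the partners at sorted positions
  `m < m'` touch, then `m' = m + 1` or `(m, m') = (0, k)`. Proof: the azimuth difference `Δ` has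
  `cos Δ = cos φ` with `φ` the tight-triangle corner (R-tri: `α₀`, `A_x(D)` or `A_p(D)`); were the
  positions not consecutive, two gaps on each side would give `Δ ∈ [2ψ, 2π − 2ψ]` (`ψ = A_x` resp.
  `A_p`), so `cos Δ ≤ cos 2ψ = 2cos²ψ − 1 < cos φ` (for `A_x`: `1/3 > 2C_x² − 1 ⇔ 3D² < 8`).

The second half ("the fan is never closed", `d ≤ 5` / `≤ 4`) and the packaged statement "every
link is a subgraph of a path" are in `Bulk/GapLinkForest.lean`.

References: engine-4's F2 note (DESIGN.md §2); O. Musin, A. Tarasov, *The strong thirteen spheres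
problem*, DCG 48 (2012), §3 (vertex stars of contact graphs) [`MusinTarasov2012`]; L. Flatley et
al., J. Comput. Appl. Math. 254 (2013), Lemma 6 (1)–(3) [`FlatleyEtAl2013`].
-/

noncomputable section

open scoped BigOperators InnerProductSpace
open Finset Real

namespace Summit.Ventures.Crystal3D

/-! ## §1 Real and index lemmas -/

section RealLemmas

/-- For `0 ≤ a ≤ π` and `x ∈ [a, 2π − a]`: `cos x ≤ cos a`. [folklore] -/
theorem cos_le_cos_of_mem_Icc {a x : ℝ} (ha0 : 0 ≤ a) (h1 : a ≤ x)
    (h2 : x ≤ 2 * π - a) : cos x ≤ cos a := by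
  by_cases hx : x ≤ π
  · exact cos_le_cos_of_nonneg_of_le_pi ha0 hx h1
  · push Not at hx
    rw [← Real.cos_two_pi_sub x]
    exact cos_le_cos_of_nonneg_of_le_pi ha0 (by linarith) (by linarith)

/-- **Two consecutive gaps on either side.** For strictly increasing `e₀ < ⋯ < e_k` in `(−π, π]`
with all cyclic gaps `≥ ψ`, two indices `m < m'` that are NOT cyclically consecutive
(`m' ≥ m + 2` and not `(m, m') = (0, k)`) have `2ψ ≤ e_{m'} − e_m ≤ 2π − 2ψ`. [folklore] -/
theorem two_gaps_le_of_not_consecutive {k : ℕ} (e : Fin (k + 1) → ℝ) (hmono : StrictMono e)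
    {ψ : ℝ}
    (hgap : ∀ m : Fin (k + 1),
      ψ ≤ e (finRotate (k + 1) m) - e m + if m = Fin.last k then 2 * π else 0)
    {m m' : Fin (k + 1)} (h2 : m.val + 2 ≤ m'.val) (hnot : ¬(m.val = 0 ∧ m'.val = k)) :
    2 * ψ ≤ e m' - e m ∧ e m' - e m ≤ 2 * π - 2 * ψ := by
  have hm'k : m'.val ≤ k := Nat.lt_succ_iff.1 m'.isLt
  have hmono' := hmono.monotone
  -- gap value at a non-last index
  have hg : ∀ t : Fin (k + 1), (ht : t.val < k) →
      ψ ≤ e ⟨t.val + 1, by omega⟩ - e t := by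
    intro t ht
    have hne : t ≠ Fin.last k := fun h => by rw [h, Fin.val_last] at ht; omega
    have h := hgap t
    rw [if_neg hne, add_zero] at h
    have hv : (finRotate (k + 1) t).val = t.val + 1 := coe_finRotate_of_ne_last hne
    have heq : finRotate (k + 1) t = ⟨t.val + 1, by omega⟩ := Fin.ext hv
    rwa [heq] at h
  -- the wrap-around gap
  have hwrap : ψ ≤ e 0 - e (Fin.last k) + 2 * π := by
    have h := hgap (Fin.last k)
    rwa [if_pos rfl, finRotate_last] at h
  constructor
  · -- two gaps inside `[e_m, e_{m'}]`
    have h1 := hg m (by omega)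
    have h2 := hg ⟨m.val + 1, by omega⟩ (by simp; omega)
    have h3 : e ⟨m.val + 1 + 1, by omega⟩ ≤ e m' :=
      hmono' (Fin.mk_le_mk.2 (by omega) : (⟨m.val + 1 + 1, by omega⟩ : Fin (k + 1)) ≤ m')
    linarith
  · by_cases hm' : m'.val < k
    · -- gap after `m'` and the wrap-around gap
      have h1 := hg m' hm'
      have h3 : e ⟨m'.val + 1, by omega⟩ ≤ e (Fin.last k) := hmono' (Fin.le_last _)
      have h4 : e 0 ≤ e m := hmono' (Fin.zero_le _)
      linarith
    · -- `m' = last`, so `m ≠ 0`: the gap before `m` and the wrap-around gap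
      have hm'k' : m'.val = k := by omega
      have hm0 : m.val ≠ 0 := fun h => hnot ⟨h, hm'k'⟩
      have h1 := hg ⟨m.val - 1, by omega⟩ (by simp; omega)
      have heq : (⟨(⟨m.val - 1, by omega⟩ : Fin (k + 1)).val + 1, by simp; omega⟩ : Fin (k + 1))
          = m := Fin.ext (by simp; omega)
      rw [heq] at h1
      have h4 : e 0 ≤ e ⟨m.val - 1, by omega⟩ := hmono' (Fin.zero_le _)
      have h5 : e m' = e (Fin.last k) := by rw [show m' = Fin.last k from Fin.ext (by simp [hm'k'])]
      linarith

/-- Sum of the other gaps: if `k + 1` nonnegative... (generic) For `f : Fin (k+1) → ℝ` with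
`∑ f = S` and `ψ ≤ f t` for all `t`, the sum over `t ≠ m` is `S − f m ≥ k·ψ`. [folklore] -/
theorem sum_erase_ge {k : ℕ} (f : Fin (k + 1) → ℝ) {S ψ : ℝ} (hS : ∑ t, f t = S)
    (hψ : ∀ t, ψ ≤ f t) (m : Fin (k + 1)) : (k : ℝ) * ψ ≤ S - f m := by
  have h1 : f m + ∑ t ∈ univ.erase m, f t = S := by
    rw [Finset.add_sum_erase _ _ (mem_univ m)]; exact hS
  have h2 : (univ.erase m).card • ψ ≤ ∑ t ∈ univ.erase m, f t :=
    Finset.card_nsmul_le_sum _ _ _ fun t _ => hψ t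
  rw [Finset.card_erase_of_mem (mem_univ m), Finset.card_univ, Fintype.card_fin, Nat.add_sub_cancel,
    nsmul_eq_mul] at h2
  linarith

end RealLemmas

/-! ## §2 The vertex star: cosines of azimuth differences, gap lower bounds -/

section VertexStar

open Literature.Geometry.DiscreteGeometry InnerProductGeometry

variable {c : Fin 14 → EuclideanSpace ℝ (Fin 3)}

/-- **Azimuth difference vs corner.** For two tight partners `j, j'` of ball `i`:
`cos (θ_{j'} − θ_j) = cos (corner c i j' j)` (both equal the normalised two-level tangent inner
product). -/
theorem IsGapConfig.cos_tightAzimuth_sub (hc : IsGapConfig c) (hD : intruderDist c < 2)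
    {i j j' : Fin 14} (hi0 : i ≠ 0) (hj : j ∈ tightNbrs c i) (hj' : j' ∈ tightNbrs c i) :
    Real.cos (tightAzimuth c i j' - tightAzimuth c i j) = Real.cos (corner c i j' j) := by
  obtain ⟨hj0, -, -⟩ := mem_tightNbrs.1 hj
  obtain ⟨hj'0, -, -⟩ := mem_tightNbrs.1 hj'
  have hform := hc.inner_eq_of_tightAzimuth hi0 hj'0 hj0
  have hκ := hc.sq_inner_gapDir_lt_one hD hi0 hj
  have hκ' := hc.sq_inner_gapDir_lt_one hD hi0 hj'
  have hcos : Real.cos (corner c i j' j) = (⟪gapDir c j', gapDir c j⟫_ℝ -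
        ⟪gapDir c i, gapDir c j'⟫_ℝ * ⟪gapDir c i, gapDir c j⟫_ℝ) /
        (√(1 - ⟪gapDir c i, gapDir c j'⟫_ℝ ^ 2) * √(1 - ⟪gapDir c i, gapDir c j⟫_ℝ ^ 2)) := by
    unfold corner
    rw [InnerProductGeometry.cos_angle,
      norm_tangentProj_eq_sqrt (hc.norm_gapDir hi0) (hc.norm_gapDir hj'0) rfl,
      norm_tangentProj_eq_sqrt (hc.norm_gapDir hi0) (hc.norm_gapDir hj0) rfl,
      inner_tangentProj_eq_twoLevel (hc.norm_gapDir hi0) rfl rfl rfl]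
  have hpos : 0 < √(1 - ⟪gapDir c i, gapDir c j'⟫_ℝ ^ 2) *
      √(1 - ⟪gapDir c i, gapDir c j⟫_ℝ ^ 2) :=
    mul_pos (Real.sqrt_pos.2 (by linarith)) (Real.sqrt_pos.2 (by linarith))
  rw [hcos, eq_div_iff hpos.ne']
  linarith [hform]

/-- The constant `C_x(D) = D/(√3 √(4 − D²)) = cos A_x(D)`: for `1 ≤ D`, `D² < 8/3`:
`1/3 ≤ C_x < 1`, `0 < C_x` and `C_x² < 2/3`. -/
theorem Cx_bounds {D : ℝ} (hD1 : 1 ≤ D) (hD83 : D ^ 2 < 8 / 3) :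
    1 / 3 ≤ D / (√3 * √(4 - D ^ 2)) ∧ D / (√3 * √(4 - D ^ 2)) < 1 ∧
      0 < D / (√3 * √(4 - D ^ 2)) ∧ (D / (√3 * √(4 - D ^ 2))) ^ 2 < 2 / 3 := by
  have h4 : 0 < 4 - D ^ 2 := by nlinarith
  have hs3 : 0 < √3 := Real.sqrt_pos.2 (by norm_num)
  have hs4 : 0 < √(4 - D ^ 2) := Real.sqrt_pos.2 h4
  have hs : 0 < √3 * √(4 - D ^ 2) := mul_pos hs3 hs4
  have hsq : (√3 * √(4 - D ^ 2)) ^ 2 = 3 * (4 - D ^ 2) := by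
    rw [mul_pow, Real.sq_sqrt (by norm_num), Real.sq_sqrt h4.le]
  refine ⟨?_, ?_, div_pos (by linarith) hs, ?_⟩
  · rw [le_div_iff₀ hs]
    nlinarith [hsq]
  · rw [div_lt_one hs]
    nlinarith [hsq]
  · rw [div_pow, hsq, div_lt_iff₀ (by linarith)]
    nlinarith

/-- The constant `C_p(D) = (2 − D²)/(4 − D²) = cos A_p(D)`: for `1 ≤ D`, `D² < 2`:
`0 < C_p ≤ 1/3`. -/
theorem Cp_bounds {D : ℝ} (hD1 : 1 ≤ D) (hD2 : D ^ 2 < 2) :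
    0 < (2 - D ^ 2) / (4 - D ^ 2) ∧ (2 - D ^ 2) / (4 - D ^ 2) ≤ 1 / 3 := by
  have h4 : 0 < 4 - D ^ 2 := by nlinarith
  refine ⟨div_pos (by linarith) h4, ?_⟩
  rw [div_le_iff₀ h4]; nlinarith

/-- `A_x(D) ≤ α₀ = arccos (1/3)` for `1 ≤ D`, `D² < 8/3`. -/
theorem Ax_le_arccos_third {D : ℝ} (hD1 : 1 ≤ D) (hD83 : D ^ 2 < 8 / 3) :
    Real.arccos (D / (√3 * √(4 - D ^ 2))) ≤ Real.arccos (1 / 3) :=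
  Real.arccos_le_arccos (Cx_bounds hD1 hD83).1

/-- `2 A_x(D) > α₀`: `cos (2 A_x(D)) < 1/3` (`D² < 8/3`). -/
theorem cos_two_Ax_lt_third {D : ℝ} (hD1 : 1 ≤ D) (hD83 : D ^ 2 < 8 / 3) :
    Real.cos (2 * Real.arccos (D / (√3 * √(4 - D ^ 2)))) < 1 / 3 := by
  obtain ⟨h1, h2, h3, h4⟩ := Cx_bounds hD1 hD83
  rw [Real.cos_two_mul, Real.cos_arccos (by linarith) h2.le]
  linarith

/-- **Every gap at a shell ball is `≥ A_x(D)`** (admissible configuration, `D² < 8/3`): a gap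
`≤ π` is the corner between its two consecutive partners (`IsGapConfig.tightGap_eq_corner`), which
is `≥ α₀ ≥ A_x` or `≥ A_x` by R-min; a gap `> π` exceeds `A_x ≤ π` trivially. -/
theorem IsGapConfig.Ax_le_tightGap (hc : IsGapConfig c) (hD83 : intruderDist c ^ 2 < 8 / 3)
    {i : Fin 14} (hi0 : i ≠ 0) (hi13 : i ≠ 13) {k : ℕ} (hd : (tightAngles c i).card = k + 1)
    (m : Fin (k + 1)) :
    Real.arccos (intruderDist c / (√3 * √(4 - intruderDist c ^ 2))) ≤ tightGap c i hd m := by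
  have hD1 := hc.one_le_intruderDist
  have hD2 : intruderDist c < 2 := by nlinarith
  have hD3 : intruderDist c ^ 2 < 3 := by linarith
  by_cases hle : tightGap c i hd m ≤ π
  · have hk : k ≠ 0 := by
      rintro rfl
      have hm : m = 0 := Fin.ext (by rw [Fin.val_zero]; exact Nat.lt_one_iff.1 m.isLt)
      subst hm
      have h2 : tightGap c i hd 0 = 2 * π := by
        unfold tightGap
        rw [finRotate_one, Equiv.refl_apply, sub_self, zero_add, if_pos (by decide)]
      linarith [pi_pos]
    rw [hc.tightGap_eq_corner hD3 hi0 hd m hle]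
    have hjm := tightNbrAt_mem c i hd m
    have hj'm := tightNbrAt_mem c i hd (finRotate (k + 1) m)
    obtain ⟨hj0, -, hdj⟩ := mem_tightNbrs.1 hjm
    obtain ⟨hj'0, -, hdj'⟩ := mem_tightNbrs.1 hj'm
    have hne : tightNbrAt c i hd (finRotate (k + 1) m) ≠ tightNbrAt c i hd m := fun h =>
      finRotate_succ_ne hk m (tightNbrAt_injective c i hd h)
    by_cases hj13 : tightNbrAt c i hd m = 13
    · have hj'13 : tightNbrAt c i hd (finRotate (k + 1) m) ≠ 13 := fun h => hne (h.trans hj13.symm)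
      rw [hj13] at hdj ⊢
      exact hc.arccos_Ax_le_corner hD2 hi0 hi13 hj'0 hj'13 hdj' hdj
    · by_cases hj'13 : tightNbrAt c i hd (finRotate (k + 1) m) = 13
      · rw [hj'13] at hdj' ⊢
        rw [corner_comm]
        exact hc.arccos_Ax_le_corner hD2 hi0 hi13 hj0 hj13 hdj hdj'
      · exact (Ax_le_arccos_third hD1 hD83).trans
          (hc.arccos_third_le_corner hi0 hi13 hj'0 hj'13 hj0 hj13 hdj' hdj hne)
  · push Not at hle
    exact (Real.arccos_le_pi _).trans hle.le

/-- **Every gap at the hole is `≥ A_p(D)`** (admissible configuration, `D² < 3`). -/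
theorem IsGapConfig.Ap_le_tightGap (hc : IsGapConfig c) (hD3 : intruderDist c ^ 2 < 3)
    {k : ℕ} (hd : (tightAngles c 13).card = k + 1) (m : Fin (k + 1)) :
    Real.arccos ((2 - intruderDist c ^ 2) / (4 - intruderDist c ^ 2)) ≤ tightGap c 13 hd m := by
  have hD1 := hc.one_le_intruderDist
  have hD2 : intruderDist c < 2 := by nlinarith
  have h13 : (13 : Fin 14) ≠ 0 := by decide
  by_cases hle : tightGap c 13 hd m ≤ π
  · have hk : k ≠ 0 := by
      rintro rfl
      have hm : m = 0 := Fin.ext (by rw [Fin.val_zero]; exact Nat.lt_one_iff.1 m.isLt)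
      subst hm
      have h2 : tightGap c 13 hd 0 = 2 * π := by
        unfold tightGap
        rw [finRotate_one, Equiv.refl_apply, sub_self, zero_add, if_pos (by decide)]
      linarith [pi_pos]
    rw [hc.tightGap_eq_corner hD3 h13 hd m hle]
    have hjm := tightNbrAt_mem c 13 hd m
    have hj'm := tightNbrAt_mem c 13 hd (finRotate (k + 1) m)
    obtain ⟨hj0, hj13, hdj⟩ := mem_tightNbrs.1 hjm
    obtain ⟨hj'0, hj'13, hdj'⟩ := mem_tightNbrs.1 hj'm
    have hne : tightNbrAt c 13 hd (finRotate (k + 1) m) ≠ tightNbrAt c 13 hd m := fun h =>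
      finRotate_succ_ne hk m (tightNbrAt_injective c 13 hd h)
    rw [dist_comm] at hdj hdj'
    exact hc.arccos_Ap_le_corner hD2 hj'0 hj'13 hj0 hj13 hdj' hdj hne
  · push Not at hle
    exact (Real.arccos_le_pi _).trans hle.le

end VertexStar

/-! ## §3 F2: touching partners are cyclically consecutive, and the fan is never closed -/

section Claims

open Literature.Geometry.DiscreteGeometry InnerProductGeometry

variable {c : Fin 14 → EuclideanSpace ℝ (Fin 3)}

/-- `2 α₀ < π` (`α₀ = arccos (1/3) < 1.2311`). [folklore] -/
theorem two_mul_arccos_third_lt_pi : 2 * Real.arccos (1 / 3) < π := by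
  have := Literature.Geometry.DiscreteGeometry.arccos_third_lt
  linarith [pi_gt_three]

/-- **F2 (a) at a shell ball: two tight partners of a shell ball `i` that touch each other are
CYCLICALLY CONSECUTIVE around `i`** (admissible configuration with `D² < 8/3`; in the sorted
azimuth order `tightNbrAt`, positions `m < m'` touch only if `m' = m + 1` or `(m, m') = (0, k)`).
Reason: their azimuth difference `Δ` has `cos Δ = cos φ`, `φ ∈ {α₀, A_x}` the corner of the tight
triangle; two gaps on each side would force `Δ ∈ [2A_x, 2π − 2A_x]`, `cos Δ ≤ cos 2A_x < 1/3`. -/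
theorem IsGapConfig.touch_consecutive_shell (hc : IsGapConfig c)
    (hD83 : intruderDist c ^ 2 < 8 / 3) {i : Fin 14} (hi0 : i ≠ 0) (hi13 : i ≠ 13) {k : ℕ}
    (hd : (tightAngles c i).card = k + 1) {m m' : Fin (k + 1)} (hlt : m < m')
    (ht : dist (c (tightNbrAt c i hd m')) (c (tightNbrAt c i hd m)) = 1) :
    m'.val = m.val + 1 ∨ (m.val = 0 ∧ m'.val = k) := by
  have hD1 := hc.one_le_intruderDist
  have hD2 : intruderDist c < 2 := by nlinarith
  by_contra H
  push Not at H
  have h2 : m.val + 2 ≤ m'.val := by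
    have := Fin.lt_def.1 hlt; omega
  have hnot : ¬(m.val = 0 ∧ m'.val = k) := fun h => H.2 h.1 h.2
  set D := intruderDist c with hDdef
  obtain ⟨hC1, hC2, hC3, hC4⟩ := Cx_bounds hD1 hD83
  set ψ := Real.arccos (D / (√3 * √(4 - D ^ 2))) with hψ
  have hgap : ∀ t : Fin (k + 1), ψ ≤ sortedTightAngle c i hd (finRotate (k + 1) t) -
      sortedTightAngle c i hd t + (if t = Fin.last k then 2 * π else 0) :=
    fun t => hc.Ax_le_tightGap hD83 hi0 hi13 hd t
  obtain ⟨hlo, hhi⟩ := two_gaps_le_of_not_consecutive (sortedTightAngle c i hd)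
    (sortedTightAngle c i hd).strictMono hgap h2 hnot
  have hψ0 : 0 ≤ ψ := Real.arccos_nonneg _
  have hψπ : 2 * ψ ≤ π := by
    have := Ax_le_arccos_third hD1 hD83
    linarith [two_mul_arccos_third_lt_pi]
  have hcosle := cos_le_cos_of_mem_Icc (by linarith) hlo hhi
  have hcos2 : Real.cos (2 * ψ) < 1 / 3 := cos_two_Ax_lt_third hD1 hD83
  have hcos2' : Real.cos (2 * ψ) = 2 * (D / (√3 * √(4 - D ^ 2))) ^ 2 - 1 := by
    rw [hψ, Real.cos_two_mul, Real.cos_arccos (by linarith) hC2.le]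
  -- `cos Δ = cos corner`
  have hjm := tightNbrAt_mem c i hd m
  have hj'm := tightNbrAt_mem c i hd m'
  have hcoseq := hc.cos_tightAzimuth_sub hD2 hi0 hjm hj'm
  rw [tightAzimuth_tightNbrAt, tightAzimuth_tightNbrAt] at hcoseq
  rw [hcoseq] at hcosle
  obtain ⟨hj0, -, hdj⟩ := mem_tightNbrs.1 hjm
  obtain ⟨hj'0, -, hdj'⟩ := mem_tightNbrs.1 hj'm
  have hne : tightNbrAt c i hd m' ≠ tightNbrAt c i hd m := fun h =>
    (ne_of_gt hlt) (tightNbrAt_injective c i hd h)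
  -- evaluate the corner of the tight triangle
  by_cases hj13 : tightNbrAt c i hd m = 13
  · have hj'13 : tightNbrAt c i hd m' ≠ 13 := fun h => hne (h.trans hj13.symm)
    rw [hj13] at hdj ht hcosle
    rw [hc.corner_eq_arccos_Ax hD2 hi0 hi13 hj'0 hj'13 hdj' hdj ht,
      Real.cos_arccos (by linarith) hC2.le] at hcosle
    nlinarith
  · by_cases hj'13 : tightNbrAt c i hd m' = 13
    · rw [hj'13] at hdj' ht hcosle
      rw [corner_comm, hc.corner_eq_arccos_Ax hD2 hi0 hi13 hj0 hj13 hdj hdj'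
        (by rw [dist_comm]; exact ht), Real.cos_arccos (by linarith) hC2.le] at hcosle
      nlinarith
    · rw [hc.corner_eq_arccos_third hi0 hi13 hj'0 hj'13 hj0 hj13 hdj' hdj ht,
        Real.cos_arccos (by norm_num) (by norm_num)] at hcosle
      nlinarith

/-- **F2 (a) at the hole**: two shell balls touching the intruder that touch each other are
cyclically consecutive around the hole direction (admissible configuration, `D² < 2`). -/
theorem IsGapConfig.touch_consecutive_intruder (hc : IsGapConfig c)
    (hD2' : intruderDist c ^ 2 < 2) {k : ℕ} (hd : (tightAngles c 13).card = k + 1)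
    {m m' : Fin (k + 1)} (hlt : m < m')
    (ht : dist (c (tightNbrAt c 13 hd m')) (c (tightNbrAt c 13 hd m)) = 1) :
    m'.val = m.val + 1 ∨ (m.val = 0 ∧ m'.val = k) := by
  have hD1 := hc.one_le_intruderDist
  have hD2 : intruderDist c < 2 := by nlinarith
  have hD3 : intruderDist c ^ 2 < 3 := by linarith
  have h13 : (13 : Fin 14) ≠ 0 := by decide
  by_contra H
  push Not at H
  have h2 : m.val + 2 ≤ m'.val := by
    have := Fin.lt_def.1 hlt; omega
  have hnot : ¬(m.val = 0 ∧ m'.val = k) := fun h => H.2 h.1 h.2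
  set D := intruderDist c with hDdef
  obtain ⟨hC1, hC2⟩ := Cp_bounds hD1 hD2'
  set ψ := Real.arccos ((2 - D ^ 2) / (4 - D ^ 2)) with hψ
  have hgap : ∀ t : Fin (k + 1), ψ ≤ sortedTightAngle c 13 hd (finRotate (k + 1) t) -
      sortedTightAngle c 13 hd t + (if t = Fin.last k then 2 * π else 0) :=
    fun t => hc.Ap_le_tightGap hD3 hd t
  obtain ⟨hlo, hhi⟩ := two_gaps_le_of_not_consecutive (sortedTightAngle c 13 hd)
    (sortedTightAngle c 13 hd).strictMono hgap h2 hnot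
  have hψπ : 2 * ψ ≤ π := by
    have := Real.arccos_lt_pi_div_two.2 hC1
    linarith
  have hcosle := cos_le_cos_of_mem_Icc (by linarith [Real.arccos_nonneg ((2 - D ^ 2) / (4 - D ^ 2))]) hlo hhi
  have hcos2' : Real.cos (2 * ψ) = 2 * ((2 - D ^ 2) / (4 - D ^ 2)) ^ 2 - 1 := by
    rw [hψ, Real.cos_two_mul, Real.cos_arccos (by linarith) (by linarith)]
  have hjm := tightNbrAt_mem c 13 hd m
  have hj'm := tightNbrAt_mem c 13 hd m'
  have hcoseq := hc.cos_tightAzimuth_sub hD2 h13 hjm hj'm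
  rw [tightAzimuth_tightNbrAt, tightAzimuth_tightNbrAt] at hcoseq
  rw [hcoseq] at hcosle
  obtain ⟨hj0, hj13, hdj⟩ := mem_tightNbrs.1 hjm
  obtain ⟨hj'0, hj'13, hdj'⟩ := mem_tightNbrs.1 hj'm
  rw [dist_comm] at hdj hdj'
  rw [hc.corner_eq_arccos_Ap hD2 hj'0 hj'13 hj0 hj13 hdj' hdj ht,
    Real.cos_arccos (by linarith) (by linarith)] at hcosle
  nlinarith

end Claims

end Summit.Ventures.Crystal3D
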